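import Mathlib
import Summits.PneNP.PneNP.Theorems.LatticeMagicBooleanSosBlindAtConstantFactorDefs
import Summits.PneNP.PneNP.Theorems.LatticeMagicBooleanSosBlindAtConstantFactorStubFooledKey
import Literature.Computability.MetaComplexity.SOSThreeColouringProofs

/-!
# PneNP / LatticeMagic — `BooleanSosBlindAtConstantFactor`, line `Sketch`: stub `stub_fooled`

The SOS half of the Construction-A road (crux stmt-PneNP-2330): the Grigoriev–Schoenebeck moment
functional `L = momentFunctional (pseudoMoment g b r Dx)` of the parity system of a clause family
`C : Fin me → Clause ℕ` (`g e = clauseVec (C e)`, `b e = clauseSign (C e)`; tree files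
`XorDerivation.lean`, `XorPseudoexpectation.lean` — PROVED), pushed forward along the local substitution
`ψ : x_(i,1) ↦ φ(x_i), x_(i,2) ↦ 1 (i < N); x_(N+e,1) ↦ h_e, x_(N+e,2) ↦ 1 − h_e,
h_e = (Σ_{v ∈ scope (C e)} φ(x_v) − rhsBit (C e))/2; every other variable ↦ 0`, is a degree-`D`
Boolean pseudoexpectation fooled by the bit-encoded closeness system (bit budget `m = 2`) of the
Construction-A instance `conAInstance N me C d₀` whenever `3 D + 3 ≤ Dx ≤ c r / 2` and `⌊d₀²⌋ = N`:
* normalisation and positivity exactly as in the tree's pushforward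
  `ThreeColGadget.threeColPseudoexpectation_of_local` (degree control `card_support_aeval_le`, `s = 3`);
* the closeness identity holds EXACTLY under `ψ` (`fooled_aeval_closenessPoly`: the message coordinates
  contribute `(2φ(x_i) − 1)² = 1` each, the check coordinates vanish identically, `⌊d₀²⌋ = N`);
* Booleanity is automatic for `φ(x_i)`, `1`, `0` and is the escape-bit identity `fooledKey`
  (`…StubFooledKey.lean`) for `h_e` and `1 − h_e`.
Sources: Grigoriev 2001 §2; Schoenebeck 2008 Thm. 4.1/§5; Tulsiani 2009 / Atserias–Ochremiak 2019 §6.4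
(pushforward along local interpretations); Conway–Sloane Construction A.
-/

set_option linter.dupNamespace false -- `Summit.PneNP.PneNP.…`: summit = sub-problem (D-0017)

namespace Summit.PneNP.PneNP.Theorems.ConA

open scoped BigOperators
open Finset MvPolynomial Literature.Algebra.EuclideanLattices Literature.Computability.Complexity
  Literature.Computability.MetaComplexity Literature.Computability.MetaComplexity.ThreeColGadget

noncomputable section

/-! ## Entries of the Construction-A basis and target -/

/-- Message/message entries: `2·I_N`. (lead, stub `stub_fooled`) -/
theorem conABasis_castAdd_castAdd {N me : ℕ} (C : Fin me → Clause ℕ) (a' a : Fin N) :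
    conABasis N me C (Fin.castAdd me a') (Fin.castAdd me a) = if a' = a then 2 else 0 := by
  simp [conABasis, Matrix.reindex_apply, Matrix.submatrix_apply, Matrix.diagonal_apply]

/-- Check/message entries: `0`. (lead, stub `stub_fooled`) -/
theorem conABasis_natAdd_castAdd {N me : ℕ} (C : Fin me → Clause ℕ) (e' : Fin me) (a : Fin N) :
    conABasis N me C (Fin.natAdd N e') (Fin.castAdd me a) = 0 := by
  simp [conABasis, Matrix.reindex_apply, Matrix.submatrix_apply]

/-- Message/check entries: the scope incidence. (lead, stub `stub_fooled`) -/
theorem conABasis_castAdd_natAdd {N me : ℕ} (C : Fin me → Clause ℕ) (a' : Fin N) (e : Fin me) :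
    conABasis N me C (Fin.castAdd me a') (Fin.natAdd N e) =
      if (a' : ℕ) ∈ clauseScope (C e) then 1 else 0 := by
  simp [conABasis, Matrix.reindex_apply, Matrix.submatrix_apply, incBlock]

/-- Check/check entries: `2·I_me`. (lead, stub `stub_fooled`) -/
theorem conABasis_natAdd_natAdd {N me : ℕ} (C : Fin me → Clause ℕ) (e' e : Fin me) :
    conABasis N me C (Fin.natAdd N e') (Fin.natAdd N e) = if e' = e then 2 else 0 := by
  simp [conABasis, Matrix.reindex_apply, Matrix.submatrix_apply, Matrix.diagonal_apply]

/-- Message entries of the target: `1`. (lead, stub `stub_fooled`) -/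
theorem conATarget_castAdd {N me : ℕ} (C : Fin me → Clause ℕ) (a : Fin N) :
    conATarget N me C (Fin.castAdd me a) = 1 := by
  simp [conATarget]

/-- Check entries of the target: the XOR right-hand sides. (lead, stub `stub_fooled`) -/
theorem conATarget_natAdd {N me : ℕ} (C : Fin me → Clause ℕ) (e : Fin me) :
    conATarget N me C (Fin.natAdd N e) = rhsBit (C e) := by
  simp [conATarget]

/-! ## The closeness identity holds exactly under the substitution -/

/-- `(2φ(x_a) − 1)² = 1` in the parity algebra. (lead, stub `stub_fooled`) -/
theorem two_phiX_sub_one_sq (a : ℕ) : (phiX a * 2 - 1) * (phiX a * 2 - 1) = (1 : ParityAlg) := by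
  have h := phiX_mul_self a
  linear_combination (4 : ParityAlg) * h

/-- **Exactness of the closeness identity.** Under any substitution `ψ` with the displayed values on
the bits of the `N + me` coefficients and on the two slack bits, and escape elements `hh e` solving
the check equations `Σ_{a : a ∈ scope (C e)} φ(x_a) − 2 hh e − rhsBit (C e) = 0`, the image of the
closeness polynomial of `conAInstance N me C d₀` with `m = 2` and `⌊d₀²⌋ = N` is ZERO.
(lead, stub `stub_fooled`) -/
theorem fooled_aeval_closenessPoly {N me : ℕ} (C : Fin me → Clause ℕ) (d₀ : ℚ)
    (hd₀ : ⌊(d₀ : ℝ) ^ 2⌋ = N) (ψ : ℕ → ParityAlg) (hh : Fin me → ParityAlg)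
    (hψ1 : ∀ a : Fin N, ψ (Nat.pair a 1) = phiX a) (hψ2 : ∀ a : Fin N, ψ (Nat.pair a 2) = 1)
    (hψ3 : ∀ e : Fin me, ψ (Nat.pair (N + e) 1) = hh e)
    (hψ4 : ∀ e : Fin me, ψ (Nat.pair (N + e) 2) = 1 - hh e) (hψ0 : ∀ bb : ℕ, ψ (Nat.pair bb 0) = 0)
    (hcheck : ∀ e : Fin me, (∑ a : Fin N, if (a : ℕ) ∈ clauseScope (C e) then phiX a else 0) -
      hh e * 2 - ((rhsBit (C e) : ℤ) : ℝ) • (1 : ParityAlg) = 0) :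
    MvPolynomial.aeval ψ (closenessPoly (conAInstance N me C d₀) 2) = 0 := by
  classical
  set Ψ := MvPolynomial.aeval (R := ℝ) ψ with hΨ
  -- the images of the constants
  have hC : ∀ z : ℤ, Ψ (MvPolynomial.C ((z : ℤ) : ℝ)) = (z : ℝ) • (1 : ParityAlg) := by
    intro z
    rw [hΨ, MvPolynomial.aeval_C, Algebra.algebraMap_eq_smul_one]
  -- the images of the coefficients `z_i`
  have hZ : ∀ i : Fin (N + me), Ψ ((∑ b ∈ Finset.range 2, ((2 : ℝ) ^ b) •
      MvPolynomial.X (Nat.pair i.val (b + 1))) - MvPolynomial.C ((2 ^ (2 - 1) : ℕ) : ℝ)) =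
      ψ (Nat.pair i 1) + (2 : ℝ) • ψ (Nat.pair i 2) - (2 : ℝ) • (1 : ParityAlg) := by
    intro i
    rw [map_sub, map_sum, Finset.sum_range_succ, Finset.sum_range_succ, Finset.sum_range_zero,
      map_smul, map_smul, MvPolynomial.aeval_X, MvPolynomial.aeval_X, MvPolynomial.aeval_C,
      Algebra.algebraMap_eq_smul_one]
    norm_num
  have hZ1 : ∀ a : Fin N, Ψ ((∑ b ∈ Finset.range 2, ((2 : ℝ) ^ b) •
      MvPolynomial.X (Nat.pair (Fin.castAdd me a).val (b + 1))) -
      MvPolynomial.C ((2 ^ (2 - 1) : ℕ) : ℝ)) = phiX a := by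
    intro a
    rw [hZ, Fin.val_castAdd, hψ1, hψ2]
    abel
  have hZ2 : ∀ e : Fin me, Ψ ((∑ b ∈ Finset.range 2, ((2 : ℝ) ^ b) •
      MvPolynomial.X (Nat.pair (Fin.natAdd N e).val (b + 1))) -
      MvPolynomial.C ((2 ^ (2 - 1) : ℕ) : ℝ)) = -hh e := by
    intro e
    rw [hZ, Fin.val_natAdd, hψ3, hψ4, two_smul, two_smul]
    abel
  -- unfold the closeness polynomial of the instance
  show Ψ ((∑ k : Fin (N + me), (∑ i : Fin (N + me), ((∑ b ∈ Finset.range 2, ((2 : ℝ) ^ b) •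
    MvPolynomial.X (Nat.pair i.val (b + 1))) - MvPolynomial.C ((2 ^ (2 - 1) : ℕ) : ℝ)) *
    MvPolynomial.C ((conABasis N me C i k : ℤ) : ℝ) -
    MvPolynomial.C ((conATarget N me C k : ℤ) : ℝ)) ^ 2) +
    (∑ b ∈ Finset.range 2, ((2 : ℝ) ^ b) • MvPolynomial.X (Nat.pair b 0)) -
    MvPolynomial.C ((⌊(d₀ : ℝ) ^ 2⌋ : ℤ) : ℝ)) = 0
  rw [map_sub, map_add, map_sum, hd₀, hC]
  -- the slack bits vanish
  have hslack : Ψ (∑ b ∈ Finset.range 2, ((2 : ℝ) ^ b) • MvPolynomial.X (Nat.pair b 0)) = 0 := by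
    rw [map_sum]
    refine Finset.sum_eq_zero fun bb _ => ?_
    rw [map_smul, MvPolynomial.aeval_X, hψ0, smul_zero]
  rw [hslack, add_zero]
  -- the columns
  have hcol : ∀ k : Fin (N + me), Ψ ((∑ i : Fin (N + me), ((∑ b ∈ Finset.range 2, ((2 : ℝ) ^ b) •
      MvPolynomial.X (Nat.pair i.val (b + 1))) - MvPolynomial.C ((2 ^ (2 - 1) : ℕ) : ℝ)) *
      MvPolynomial.C ((conABasis N me C i k : ℤ) : ℝ) -
      MvPolynomial.C ((conATarget N me C k : ℤ) : ℝ)) ^ 2) =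
      (∑ i : Fin (N + me), Ψ ((∑ b ∈ Finset.range 2, ((2 : ℝ) ^ b) •
        MvPolynomial.X (Nat.pair i.val (b + 1))) - MvPolynomial.C ((2 ^ (2 - 1) : ℕ) : ℝ)) *
        ((conABasis N me C i k : ℤ) : ℝ) • (1 : ParityAlg) -
        ((conATarget N me C k : ℤ) : ℝ) • (1 : ParityAlg)) ^ 2 := by
    intro k
    rw [map_pow, map_sub, map_sum, hC]
    congr 2
    exact Finset.sum_congr rfl fun i _ => by rw [map_mul, hC]
  simp_rw [hcol]
  rw [Fin.sum_univ_add]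
  -- message columns: `(2 φ(x_a) − 1)² = 1`
  have hmsg : ∀ a : Fin N, (∑ i : Fin (N + me), Ψ ((∑ b ∈ Finset.range 2, ((2 : ℝ) ^ b) •
      MvPolynomial.X (Nat.pair i.val (b + 1))) - MvPolynomial.C ((2 ^ (2 - 1) : ℕ) : ℝ)) *
      ((conABasis N me C i (Fin.castAdd me a) : ℤ) : ℝ) • (1 : ParityAlg) -
      ((conATarget N me C (Fin.castAdd me a) : ℤ) : ℝ) • (1 : ParityAlg)) ^ 2 = 1 := by
    intro a
    rw [Fin.sum_univ_add]
    simp_rw [hZ1, hZ2, conABasis_castAdd_castAdd, conABasis_natAdd_castAdd, conATarget_castAdd]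
    simp_rw [Int.cast_ite, ite_smul]
    simp only [Int.cast_ofNat, Int.cast_zero, zero_smul, mul_ite, mul_zero, Finset.sum_ite_eq',
      Finset.mem_univ, if_true, Finset.sum_const_zero, add_zero, Int.cast_one, one_smul]
    rw [two_smul, one_add_one_eq_two, sq]
    exact two_phiX_sub_one_sq a
  -- check columns vanish
  have hchk : ∀ e : Fin me, (∑ i : Fin (N + me), Ψ ((∑ b ∈ Finset.range 2, ((2 : ℝ) ^ b) •
      MvPolynomial.X (Nat.pair i.val (b + 1))) - MvPolynomial.C ((2 ^ (2 - 1) : ℕ) : ℝ)) *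
      ((conABasis N me C i (Fin.natAdd N e) : ℤ) : ℝ) • (1 : ParityAlg) -
      ((conATarget N me C (Fin.natAdd N e) : ℤ) : ℝ) • (1 : ParityAlg)) ^ 2 = 0 := by
    intro e
    rw [Fin.sum_univ_add]
    simp_rw [hZ1, hZ2, conABasis_castAdd_natAdd, conABasis_natAdd_natAdd, conATarget_natAdd]
    simp_rw [Int.cast_ite, ite_smul]
    simp only [Int.cast_ofNat, Int.cast_zero, zero_smul, mul_ite, mul_zero, Finset.sum_ite_eq',
      Finset.mem_univ, if_true, Int.cast_one, one_smul, mul_one]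
    rw [two_smul, one_add_one_eq_two, neg_mul, ← sub_eq_add_neg, hcheck e, sq, zero_mul]
  simp_rw [hmsg, hchk]
  simp [Int.cast_natCast, Nat.cast_smul_eq_nsmul]


/-! ## The pushforward -/

/-- Support of the escape element: the three variables of the clause. (lead, stub `stub_fooled`) -/
theorem suppIn_escape (L : Fin 3 → Literal ℕ) (rb : ℝ) :
    SuppIn (locScope L) ((1 / 2 : ℝ) • ((∑ j, phiX (L j).1) - rb • (1 : ParityAlg))) := by
  refine (SuppIn.sub (SuppIn.sum fun j _ => ?_) ((suppIn_one _).smul rb)).smul _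
  refine (suppIn_phiX (L j).1).mono ?_
  intro v hv
  rw [Finset.mem_singleton] at hv
  subst hv
  exact Finset.mem_biUnion.2 ⟨j, Finset.mem_univ _, Finset.mem_singleton_self _⟩

/-- **STUB `stub_fooled` (lead).** The pushforward of the Grigoriev–Schoenebeck functional of the
parity system of `C` along the Construction-A substitution `ψ` is a degree-`D` Boolean pseudoexpectation
fooled by the closeness system (bit budget `2`) of `conAInstance N me C d₀`, provided the scope vectors
are `(r, c)`-vector expanding (`c > 0`, `r ≥ 2`), `3 D + 3 ≤ Dx ≤ c r / 2`, and `⌊d₀²⌋ = N`.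
[Grigoriev 2001 §2; Schoenebeck 2008 Thm. 4.1/§5; Atserias–Ochremiak 2019 §6.4 (pushforward);
Conway–Sloane Construction A] -/
theorem stub_fooled {N me : ℕ} (C : Fin me → Clause ℕ) (hC : ∀ e, C e ∈ kClauses 3 N)
    {r c : ℝ} {Dx D : ℕ} (hexp : VecExpands (fun e => clauseVec (C e)) r c) (hc : 0 < c) (hr : 2 ≤ r)
    (hDx : (Dx : ℝ) ≤ c * r / 2) (hD : 3 * D + 3 ≤ Dx) (d₀ : ℚ) (hd₀ : ⌊(d₀ : ℝ) ^ 2⌋ = N) :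
    Fooled D (conAInstance N me C d₀) 2 := by
  classical
  -- the clauses as `List.ofFn` of three literals on distinct variables `< N`
  have hlen : ∀ e, (C e).length = 3 := fun e => length_of_mem_kClauses (hC e)
  obtain ⟨Lit, hLit⟩ : ∃ Lit : Fin me → Fin 3 → Literal ℕ,
      Lit = fun e j => (C e)[j.val]'(by rw [hlen]; exact j.isLt) := ⟨_, rfl⟩
  have hCL : ∀ e, C e = List.ofFn (Lit e) := fun e => by rw [hLit]; exact eq_ofFn_of_length (hlen e)
  have hnd : ∀ e, ((List.ofFn (Lit e)).map Prod.fst).Nodup := fun e => by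
    rw [← hCL]; exact nodup_map_fst_of_mem_kClauses (hC e)
  have hvar : ∀ e j, (Lit e j).1 < N := by
    intro e j
    have hmem : Lit e j ∈ C e := by rw [hLit]; exact List.getElem_mem _
    have h1 : (Lit e j).1 ∈ clauseScope (C e) := mem_clauseScope.2 ⟨(Lit e j).2, hmem⟩
    simpa using clauseScope_subset_range (hC e) h1
  -- signs of the parity system
  set g : Fin me → ParityVec := fun e => clauseVec (C e) with hg
  set b : Fin me → ℝ := fun e => clauseSign (C e) with hb
  have hbb : ∀ e, b e * b e = 1 := fun e => clauseSign_mul_self _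
  have hr0 : (0 : ℝ) ≤ r := by linarith
  have hgi : ∀ e, g e = clauseVec (List.ofFn (Lit e)) := fun e => by rw [hg, ← hCL]
  have hbi : ∀ e, b e = clauseSign (List.ofFn (Lit e)) := fun e => by rw [hb, ← hCL]
  -- the XOR right-hand sides and the escape elements
  have hrb : ∀ e, ((rhsBit (C e) : ℤ) : ℝ) = if (∏ j, litSignZ (Lit e j)) = 1 then 1 else 0 :=
    fun e => by rw [hCL]; exact rhsBit_ofFn (Lit e)
  obtain ⟨hh, hhh⟩ : ∃ hh : Fin me → ParityAlg, hh = fun e =>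
      (1 / 2 : ℝ) • ((∑ j, phiX (Lit e j).1) - ((rhsBit (C e) : ℤ) : ℝ) • (1 : ParityAlg)) :=
    ⟨_, rfl⟩
  have hdef : ∀ e, hh e =
      (1 / 2 : ℝ) • ((∑ j, phiX (Lit e j).1) - ((rhsBit (C e) : ℤ) : ℝ) • (1 : ParityAlg)) :=
    fun e => by rw [hhh]
  have hsuppH : ∀ e, SuppIn (locScope (Lit e)) (hh e) := fun e => by
    rw [hdef]; exact suppIn_escape (Lit e) _
  -- the substitution
  obtain ⟨F1, hF1⟩ : ∃ F1 : ℕ → ParityAlg, F1 = fun a =>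
      if a < N then phiX a else if h' : a - N < me then hh ⟨a - N, h'⟩ else 0 := ⟨_, rfl⟩
  obtain ⟨F2, hF2⟩ : ∃ F2 : ℕ → ParityAlg, F2 = fun a =>
      if a < N then 1 else if h' : a - N < me then 1 - hh ⟨a - N, h'⟩ else 0 := ⟨_, rfl⟩
  obtain ⟨ψ, hψ⟩ : ∃ ψ : ℕ → ParityAlg, ψ = fun v =>
      if v.unpair.2 = 1 then F1 v.unpair.1 else if v.unpair.2 = 2 then F2 v.unpair.1 else 0 :=
    ⟨_, rfl⟩
  have hψ1 : ∀ a : Fin N, ψ (Nat.pair a 1) = phiX a := fun a => by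
    rw [hψ]; simp [Nat.unpair_pair, hF1, a.isLt]
  have hψ2 : ∀ a : Fin N, ψ (Nat.pair a 2) = 1 := fun a => by
    rw [hψ]; simp [Nat.unpair_pair, hF2, a.isLt]
  have hψ3 : ∀ e : Fin me, ψ (Nat.pair (N + e) 1) = hh e := fun e => by
    rw [hψ]; simp [Nat.unpair_pair, hF1, e.isLt]
  have hψ4 : ∀ e : Fin me, ψ (Nat.pair (N + e) 2) = 1 - hh e := fun e => by
    rw [hψ]; simp [Nat.unpair_pair, hF2, e.isLt]
  have hψ0 : ∀ bb : ℕ, ψ (Nat.pair bb 0) = 0 := fun bb => by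
    rw [hψ]; simp [Nat.unpair_pair]
  -- every image is `0`, `1`, `φ(x_a)`, `hh e` or `1 - hh e`
  have hcases : ∀ v, ψ v = 0 ∨ ψ v = 1 ∨ (∃ a, ψ v = phiX a) ∨ ∃ e, ψ v = hh e ∨ ψ v = 1 - hh e := by
    intro v
    rw [hψ]
    simp only
    split_ifs with h1 h2
    · rw [hF1]
      simp only
      split_ifs with h3 h4
      · exact Or.inr (Or.inr (Or.inl ⟨_, rfl⟩))
      · exact Or.inr (Or.inr (Or.inr ⟨_, Or.inl rfl⟩))
      · exact Or.inl rfl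
    · rw [hF2]
      simp only
      split_ifs with h3 h4
      · exact Or.inr (Or.inl rfl)
      · exact Or.inr (Or.inr (Or.inr ⟨_, Or.inr rfl⟩))
      · exact Or.inl rfl
    · exact Or.inl rfl
  -- supports of the images: at most three variables each
  have hQsupp : ∀ v, ∃ B : Finset ℕ, B.card ≤ 3 ∧ SuppIn B (ψ v) := by
    intro v
    rcases hcases v with h | h | ⟨a, h⟩ | ⟨e, h | h⟩ <;> rw [h]
    · exact ⟨∅, by simp, suppIn_zero _⟩
    · exact ⟨∅, by simp, suppIn_one _⟩
    · exact ⟨{a}, by simp, suppIn_phiX a⟩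
    · exact ⟨locScope (Lit e), card_locScope_le _, hsuppH e⟩
    · exact ⟨locScope (Lit e), card_locScope_le _, (suppIn_one _).sub (hsuppH e)⟩
  -- Booleanity defect of the images: zero, or the defect of an escape element
  have hbool : ∀ v, ψ v * ψ v - ψ v = 0 ∨ ∃ e, ψ v * ψ v - ψ v = hh e * hh e - hh e := by
    intro v
    rcases hcases v with h | h | ⟨a, h⟩ | ⟨e, h | h⟩ <;> rw [h]
    · exact Or.inl (by rw [mul_zero, sub_zero])
    · exact Or.inl (by rw [mul_one, sub_self])
    · exact Or.inl (by rw [phiX_mul_self, sub_self])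
    · exact Or.inr ⟨e, rfl⟩
    · exact Or.inr ⟨e, by ring⟩
  -- the check equations hold exactly
  have hcheck : ∀ e : Fin me, (∑ a : Fin N, if (a : ℕ) ∈ clauseScope (C e) then phiX a else 0) -
      hh e * 2 - ((rhsBit (C e) : ℤ) : ℝ) • (1 : ParityAlg) = 0 := by
    intro e
    have hsum : (∑ a : Fin N, if (a : ℕ) ∈ clauseScope (C e) then phiX a else 0) =
        ∑ j, phiX (Lit e j).1 := by
      rw [← sum_clauseScope_ofFn (Lit e) (hnd e) phiX, ← hCL, ← Finset.sum_filter]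
      refine Finset.sum_bij (fun (a : Fin N) _ => (a : ℕ)) ?_ ?_ ?_ ?_
      · intro a ha
        exact (Finset.mem_filter.1 ha).2
      · intro a₁ _ a₂ _ h
        exact Fin.ext h
      · intro v hv
        have hvN : v < N := by simpa using clauseScope_subset_range (hC e) hv
        exact ⟨⟨v, hvN⟩, Finset.mem_filter.2 ⟨Finset.mem_univ _, hv⟩, rfl⟩
      · intro a _
        rfl
    rw [hsum, hdef, smul_sub, sub_mul, smul_mul_assoc, smul_mul_assoc]
    rw [show ((1 / 2 : ℝ) • ((∑ j, phiX (Lit e j).1) * 2) : ParityAlg) = ∑ j, phiX (Lit e j).1 by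
      rw [mul_two, ← two_smul ℝ, smul_smul]; norm_num]
    rw [show ((1 / 2 : ℝ) • ((((rhsBit (C e) : ℤ) : ℝ) • (1 : ParityAlg)) * 2) : ParityAlg) =
        ((rhsBit (C e) : ℤ) : ℝ) • (1 : ParityAlg) by
      rw [mul_two, ← two_smul ℝ, smul_smul]; norm_num]
    abel
  -- the functional
  set Ψ := MvPolynomial.aeval (R := ℝ) ψ with hΨ
  have hdeg : ∀ q : MvPolynomial ℕ ℝ, ∀ U ∈ (Ψ q).coeff.support,
      U.support.card ≤ 3 * q.totalDegree := fun q U hU => card_support_aeval_le hQsupp q hU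
  refine ⟨momentFunctional (pseudoMoment g b r Dx) ∘ₗ Ψ.toLinearMap, ⟨?_, ?_⟩, ?_, ?_⟩
  · -- normalisation
    show momentFunctional _ (Ψ 1) = 1
    rw [map_one, AddMonoidAlgebra.one_def, momentFunctional_single, one_mul,
      pseudoMoment_zero hexp hc hDx hr0]
  · -- positivity
    intro p hp
    show 0 ≤ momentFunctional _ (Ψ (p * p))
    rw [map_mul, momentFunctional_mul]
    refine pseudoMoment_quadratic_nonneg hexp hc hDx hr0 hbb _ (fun T => (Ψ p).coeff T) ?_
    intro T hT
    have h1 := hdeg p T hT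
    omega
  · -- Booleanity
    intro v q hq
    show momentFunctional _ (Ψ (boolAxiom v * q)) = 0
    rw [map_mul, boolAxiom, map_sub, map_pow, MvPolynomial.aeval_X, sq]
    rcases hbool v with h0 | ⟨e, he⟩
    · rw [h0, zero_mul, map_zero]
    · rw [he]
      refine fooledKey hexp hc hDx hr hbb (Lit e) e (hgi e) (hbi e) _ (hrb e) (hh e) (hdef e) (Ψ q) ?_
      intro U hU
      have h1 := hdeg q U hU
      have h2 : q.totalDegree ≤ D := le_trans (Nat.le_add_left _ _) hq
      calc U.support.card + 3 ≤ 3 * q.totalDegree + 3 := by omega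
        _ ≤ 3 * D + 3 := by omega
        _ ≤ Dx := hD
  · -- the closeness identity: exact under `ψ`
    intro q _
    show momentFunctional _ (Ψ (closenessPoly (conAInstance N me C d₀) 2 * q)) = 0
    rw [map_mul, hΨ, fooled_aeval_closenessPoly C d₀ hd₀ ψ hh hψ1 hψ2 hψ3 hψ4 hψ0 hcheck, zero_mul,
      map_zero]

end

end Summit.PneNP.PneNP.Theorems.ConA
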